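import Summits.PneNP.PneNP.Theorems.ConstantBand.Negative.LoadBearing

/-!
# `SliceTarget` (stmt-PneNP-2832), line `Sketch-ideator3-r1` — stub T2 `FibreMin`

The purely combinatorial fibre-decoupling step of the locality floor: if `f` is determined by the
coordinates in `F`, and on every fibre `{x ∈ slice_j : x|_F = ρ|_F}` each value of `g` is taken with
density `≥ α`, then `f ≠ g` on at least `α · #slice_j` points of the slice.

Proof: partition the slice into the fibres of the projection `proj x := (e ↦ if e ∈ F then x e else false)`;
on the fibre of `x₀` the function `f` is constant `= f x₀`, so the fibre's part of `{f ≠ g}` contains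
`{x ∈ fibre : g x = !f x₀}`, of cardinality `≥ α · #fibre` (the hypothesis at `ρ := x₀`, `b := !f x₀`);
sum over the fibres. The statement holds for an arbitrary finset of Boolean functions in place of the
slice (`fibreMin_general`, any finite index type); the registered stub `stub_fibreMin` is its specialisation
to `s := slice n j`.
-/

set_option linter.dupNamespace false

namespace Summit.PneNP.PneNP.Cruxes.SliceTarget.Ideator3Line

open Literature.Computability.Complexity Finset Filter Classical
open Summit.PneNP.PneNP.Theorems.ConstantBand.Negative (Edge slice)

/-- **Fibre decoupling** over an arbitrary finset `s` of Boolean functions on a finite index type: if `f` is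
determined by the coordinates in `F` and, on every fibre `{x ∈ s : x|_F = ρ|_F}`, each value `b` of `g` is taken
on at least `α · #fibre` points, then `f ≠ g` on at least `α · #s` points of `s`. (Finiteness of `ι` is only used
to make the decidability instances of the statement agree with those of `stub_fibreMin`.) [folklore] -/
theorem fibreMin_general {ι : Type*} [Fintype ι] [DecidableEq ι] (s : Finset (ι → Bool)) (F : Finset ι)
    (f g : (ι → Bool) → Bool) (α : ℝ)
    (hf : ∀ x y : ι → Bool, (∀ e ∈ F, x e = y e) → f x = f y)
    (hg : ∀ (ρ : ι → Bool) (b : Bool),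
      α * #(s.filter fun x => ∀ e ∈ F, x e = ρ e) ≤
        #(s.filter fun x => (∀ e ∈ F, x e = ρ e) ∧ g x = b)) :
    α * #s ≤ #(s.filter fun x => f x ≠ g x) := by
  -- the projection onto the coordinates in `F` (all other coordinates reset to `false`)
  let proj : (ι → Bool) → ι → Bool := fun x e => if e ∈ F then x e else false
  have hproj : ∀ x y : ι → Bool, proj x = proj y ↔ ∀ e ∈ F, x e = y e := by
    intro x y
    constructor
    · intro h e he
      have h' := congrFun h e
      simpa [proj, he] using h'
    · intro h
      funext e
      by_cases he : e ∈ F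
      · simp [proj, he, h e he]
      · simp [proj, he]
  -- fibrewise decomposition of `s` and of `{x ∈ s : f x ≠ g x}` along `proj`
  have h1 : (#s : ℝ) = ∑ p ∈ s.image proj, (#(s.filter fun x => proj x = p) : ℝ) := by
    rw [card_eq_sum_card_image proj s, Nat.cast_sum]
  have h2 : (#(s.filter fun x => f x ≠ g x) : ℝ) =
      ∑ p ∈ s.image proj, (#((s.filter fun x => f x ≠ g x).filter fun x => proj x = p) : ℝ) := by
    rw [card_eq_sum_card_fiberwise (f := proj) (s := s.filter fun x => f x ≠ g x) (t := s.image proj)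
      fun x hx => mem_image_of_mem proj (mem_of_mem_filter x hx), Nat.cast_sum]
  rw [h1, h2, mul_sum]
  refine sum_le_sum fun p hp => ?_
  obtain ⟨x₀, -, rfl⟩ := mem_image.1 hp
  -- the fibre of `proj x₀` is the set of `x ∈ s` agreeing with `x₀` on `F`
  have hfib : (s.filter fun x => proj x = proj x₀) = s.filter fun x => ∀ e ∈ F, x e = x₀ e :=
    filter_congr fun x _ => hproj x x₀
  -- on this fibre `f ≡ f x₀`, so `{g = !f x₀} ∩ fibre ⊆ {f ≠ g} ∩ fibre`
  have hsub : (s.filter fun x => (∀ e ∈ F, x e = x₀ e) ∧ g x = !f x₀) ⊆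
      (s.filter fun x => f x ≠ g x).filter fun x => proj x = proj x₀ := by
    intro x hx
    simp only [mem_filter] at hx ⊢
    obtain ⟨hxs, hF, hgx⟩ := hx
    refine ⟨⟨hxs, ?_⟩, (hproj x x₀).2 hF⟩
    rw [hf x x₀ hF, hgx]
    cases f x₀ <;> decide
  calc α * (#(s.filter fun x => proj x = proj x₀) : ℝ)
      = α * #(s.filter fun x => ∀ e ∈ F, x e = x₀ e) := by rw [hfib]
    _ ≤ #(s.filter fun x => (∀ e ∈ F, x e = x₀ e) ∧ g x = !f x₀) := hg x₀ (!f x₀)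
    _ ≤ #((s.filter fun x => f x ≠ g x).filter fun x => proj x = proj x₀) := by
      exact_mod_cast card_le_card hsub

/-- **Stub T2 `FibreMin`** of line `Sketch-ideator3-r1` (registered signature): the fibre-decoupling step on
the Hamming slice `slice n j` — `fibreMin_general` specialised to `s := slice n j`. [folklore] -/
theorem stub_fibreMin :
    ∀ (n j : ℕ) (F : Finset (Edge n)) (f g : (Edge n → Bool) → Bool) (α : ℝ),
      (∀ x y : Edge n → Bool, (∀ e ∈ F, x e = y e) → f x = f y) →
      (∀ (ρ : Edge n → Bool) (b : Bool),
        α * #((slice n j).filter fun x => ∀ e ∈ F, x e = ρ e) ≤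
          #((slice n j).filter fun x => (∀ e ∈ F, x e = ρ e) ∧ g x = b)) →
      α * #(slice n j) ≤ #((slice n j).filter fun x => f x ≠ g x) :=
  fun n j F f g α hf hg => fibreMin_general (slice n j) F f g α hf hg

end Summit.PneNP.PneNP.Cruxes.SliceTarget.Ideator3Line
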